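import Summits.ResolutionOfSingularities.ResolutionOfSingularities.Theorems.HilbertSamuelEliminationSigmaMaxModificationsCorridor3CPFrameFaceReading
import Literature.AlgebraicGeometry.Resolution.RegularLocalRingsNormal
import HarnessLib

/-!
# [OURS · L1 W4.2] D18 — THE FACE READING IN ANY CODIMENSION, modulo the projected minimality (CP 2019 Prop. 2.4, 2nd statement): a face
# `V(u_T)` of a CP frame over whose generic point `h` has multiplicity `m` reads `V(X, u_T)` and is legal
# (cell res-hironaka, LADDER-RESOLUTION rung L; slot W4.2, crux chain w42 `SigmaMaxModificationsCorridor3` stmt-ResolutionOfSingularities-19249;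
# `--supports stmt-ResolutionOfSingularities-19249 --as helper`; res-L1-w42-plan-1 RULING v3.14-44 (KQ)(1) «F3's binder must ADMIT |J| = 1 … route
# of record = CP 2019 Prop 2.4 (second statement) as a STATEMENT-ONLY FACT»; hand res-D-brk-3 (gen 7), file F1c)

PURE COMMUTATIVE ALGEBRA, 0 `def`s, every declaration PROVED; OURS bookkeeping; NOT a statement of Hironaka's manuscript [Hironaka2017] nor of
[CossartPiltant2019]/[CossartJannsenSaito2020]. AI-written, weaker than expert review.

* **`eq_span_and_coeff_mem_pow_of_isMinimal_comp`** — `R` regular local of dimension `n` with r.s.p. `u`, `h` monic of degree `m ≥ 1`, `T` ANY set of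
  indices, and the PROJECTED minimality `IsMinimal (u|_T) h` (Def. 2.4 for the sub-family `{u_j}_{j∈T}`, coefficient classes in `R/(u_T)`; for a
  MINIMAL full frame this is CP 2019 Prop. 2.4, second statement — the lane's fact candidate `CossartPiltant2019_prop_2_4_projection`, consumed
  here as the hypothesis `hminT`); `𝔔` a prime of `R[X]` over the generic point of `V(u_T)` with `s·h ∈ 𝔔^m`, `s ∉ 𝔔` ⟹ `𝔔 = (u_T)·R[X] + (X)` and
  `∀ i ∈ Icc 1 m, coeff_{m−i} h ∈ (u_T)^i`. No characteristic hypothesis. Route: `R/(u_T)` is regular (`IsRsopPart.isRegularLocalRing_quotient`)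
  hence integrally closed (tree `isIntegrallyClosed_of_isRegularLocalRing`, Auslander–Buchsbaum), so `h ≡ (X − λ)^m (mod (u_T))` with `λ ∈ R`
  (`exists_eq_X_sub_C_pow_of_mul_mem_pow`, p552261); then CP Prop. 2.3's «`0` is not a solvable vertex» for the sub-family — the tree's
  `IsRsopPart.mem_span_of_isMinimal_of_map_eq_X_sub_C_pow` — gives `λ ∈ (u_T)`; legality as in p552261.
  The codimension-two case WITHOUT the projection hypothesis (from full minimality, equicharacteristic) is p552261's
  `eq_span_and_coeff_mem_pow_of_isMinimal_of_mul_mem_pow`; points (`T = univ`) need nothing.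

References: CP 2019 = arXiv:1412.0868v1, Prop. 2.3, Prop. 2.4 (p. 12), proof of Prop. 2.7 (p. 14) [CossartPiltant2019]; Matsumura Thms. 14.2, 16.2, 19.4
[Matsumura1987].
-/

noncomputable section

set_option linter.dupNamespace false

open IsLocalRing Polynomial Finset
open Literature.AlgebraicGeometry.Resolution Literature.AlgebraicGeometry.Resolution.CossartPiltant

universe u

namespace Summit.ResolutionOfSingularities.ResolutionOfSingularities.Theorems.SigmaMaxModificationsCorridor3.Helpers

variable {R : Type u} [CommRing R] [IsRegularLocalRing R]

/-- [OURS · L1 W4.2] **THE FACE READING in any codimension, modulo projected minimality.** See the module docstring.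
[cite: CossartPiltant2019, Prop. 2.3–2.4 and proof of Prop. 2.7 (arXiv v1 pp. 11–14)] [cite: Matsumura1987, Thm. 16.2 (ii), Thm. 19.4] -/
theorem eq_span_and_coeff_mem_pow_of_isMinimal_comp {n : ℕ} (hdim : ringKrullDim R = n) (u : Fin n → R) (hu : Ideal.span (Set.range u) = maximalIdeal R)
    {h : R[X]} (hmo : h.Monic) (hm : 0 < h.natDegree) (T : Finset (Fin n))
    (hminT : IsMinimal (u ∘ (fun i => T.orderEmbOfFin rfl i)) h)
    (𝔔 : Ideal R[X]) [h𝔔p : 𝔔.IsPrime] (h𝔔 : 𝔔.comap (C : R →+* R[X]) = Ideal.span (u '' ↑T))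
    (hord : ∃ s ∉ 𝔔, s * h ∈ 𝔔 ^ h.natDegree) :
    𝔔 = (Ideal.span (u '' ↑T)).map (C : R →+* R[X]) ⊔ Ideal.span {X} ∧
      ∀ i ∈ Finset.Icc 1 h.natDegree, h.coeff (h.natDegree - i) ∈ Ideal.span (u '' ↑T) ^ i := by
  classical
  set m := h.natDegree with hmdef
  -- the sub-family `z = u|_T`
  set z : Fin T.card → R := u ∘ (fun i => T.orderEmbOfFin rfl i) with hz
  have hzr : Set.range z = u '' ↑T := by
    rw [hz, Set.range_comp]
    exact congrArg _ (Finset.range_orderEmbOfFin T rfl)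
  rw [← hzr] at h𝔔 ⊢
  set 𝔭 := Ideal.span (Set.range z) with h𝔭
  -- `u` is an r.s.p., `z` part of one
  have hd : (maximalIdeal R).spanFinrank = n := by
    have h1 := IsRegularLocalRing.spanFinrank_maximalIdeal (R := R)
    rw [hdim] at h1
    exact_mod_cast h1
  have hzu : IsRsopPart u := ⟨‹_›, 0, Fin.elim0, by rw [hdim, Nat.add_zero], by
    rw [← hu]; congr 1; ext x; simp⟩
  have hzT : IsRsopPart z := hzu.comp _ (T.orderEmbOfFin rfl).injective
  have hprime : 𝔭.IsPrime := hzT.isPrime_span_range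
  have h𝔭le : 𝔭 ≤ maximalIdeal R := hzT.span_range_le_maximalIdeal
  -- the regular (hence integrally closed) domain `D = R/𝔭`
  set D := R ⧸ 𝔭 with hD
  haveI : IsDomain D := Ideal.Quotient.isDomain 𝔭
  haveI : IsRegularLocalRing D := hzT.isRegularLocalRing_quotient
  haveI : IsIntegrallyClosed D := isIntegrallyClosed_of_isRegularLocalRing D
  -- the reduction `ρ : R[X] → D[X]` and the prime `Q = ρ(𝔔)`
  set ρ : R[X] →+* D[X] := mapRingHom (Ideal.Quotient.mk 𝔭) with hρ
  have hρsurj : Function.Surjective ρ := Polynomial.map_surjective _ Ideal.Quotient.mk_surjective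
  have hker : RingHom.ker ρ = 𝔭.map (C : R →+* R[X]) := by
    rw [hρ, Polynomial.ker_mapRingHom, Ideal.mk_ker]
  have h𝔭𝔔 : 𝔭.map (C : R →+* R[X]) ≤ 𝔔 := by rw [Ideal.map_le_iff_le_comap, h𝔔]
  have hker𝔔 : RingHom.ker ρ ≤ 𝔔 := hker ▸ h𝔭𝔔
  set Q : Ideal D[X] := 𝔔.map ρ with hQ
  haveI hQp : Q.IsPrime := Ideal.map_isPrime_of_surjective hρsurj hker𝔔
  have hcomapQ : Q.comap ρ = 𝔔 := by
    rw [hQ, Ideal.comap_map_of_surjective ρ hρsurj, ← RingHom.ker_eq_comap_bot, sup_eq_left.mpr hker𝔔]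
  have hQ0 : Q.comap (C : D →+* D[X]) = ⊥ := by
    refine (Submodule.eq_bot_iff _).mpr fun d hd => ?_
    obtain ⟨d, rfl⟩ := Ideal.Quotient.mk_surjective d
    rw [Ideal.mem_comap, ← Polynomial.map_C (Ideal.Quotient.mk 𝔭), ← Polynomial.coe_mapRingHom, ← hρ, ← Ideal.mem_comap, hcomapQ,
      ← Ideal.mem_comap, h𝔔] at hd
    exact Ideal.Quotient.eq_zero_iff_mem.mpr hd
  -- the reduced equation `g = h mod 𝔭` has multiplicity `m` at `Q`
  set g := h.map (Ideal.Quotient.mk 𝔭) with hg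
  have hgmo : g.Monic := hmo.map _
  have hgdeg : g.natDegree = m := hmo.natDegree_map _
  obtain ⟨s, hs𝔔, hsh⟩ := hord
  have hordQ : ∃ s' ∉ Q, s' * g ∈ Q ^ g.natDegree := by
    refine ⟨ρ s, fun h1 => hs𝔔 (hcomapQ ▸ Ideal.mem_comap.mpr h1), ?_⟩
    rw [hgdeg, hg, ← Polynomial.coe_mapRingHom, ← hρ, ← map_mul, hQ, ← Ideal.map_pow]
    exact Ideal.mem_map_of_mem _ hsh
  obtain ⟨lam, hglam, hQlam⟩ := exists_eq_X_sub_C_pow_of_mul_mem_pow hgmo (hgdeg ▸ hm) Q hQ0 hordQ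
  obtain ⟨lam₀, rfl⟩ := Ideal.Quotient.mk_surjective lam
  -- `λ₀ ∈ 𝔭`: `0` is not a solvable vertex of the (minimal) projected polyhedron `Δ(h; u_T; X)` (CP Prop. 2.3)
  have hlam𝔭 : lam₀ ∈ 𝔭 := by
    refine hzT.mem_span_of_isMinimal_of_map_eq_X_sub_C_pow hm hminT ?_
    rw [← hg, hglam, hgdeg]
  -- hence `g = X^m`, `Q = (X)`, `𝔔 = 𝔭·R[X] + (X)`
  have hlam0 : Ideal.Quotient.mk 𝔭 lam₀ = 0 := Ideal.Quotient.eq_zero_iff_mem.mpr hlam𝔭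
  rw [hlam0, map_zero, sub_zero] at hQlam
  have h𝔔eq : 𝔔 = 𝔭.map (C : R →+* R[X]) ⊔ Ideal.span {X} := by
    rw [← hcomapQ, hQlam]
    ext q
    rw [Ideal.mem_comap, Ideal.mem_span_singleton, Polynomial.X_dvd_iff, mem_map_C_sup_span_X_iff, hρ, Polynomial.coe_mapRingHom,
      Polynomial.coeff_map, Ideal.Quotient.eq_zero_iff_mem]
  refine ⟨h𝔔eq, ?_⟩
  -- legality, by the `𝔭`-primary calculus
  rw [h𝔔eq] at hs𝔔 hsh
  have hs0 : s.coeff 0 ∉ 𝔭 := fun h0 => hs𝔔 ((mem_map_C_sup_span_X_iff 𝔭 s).mpr h0)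
  have hcoefsh : ∀ l, (s * h).coeff l ∈ 𝔭 ^ (m - l) := coeff_mem_pow_of_mem_pow_map_C_sup_span_X 𝔭 hsh
  have hleg : ∀ b, h.coeff b ∈ 𝔭 ^ (m - b) := by
    intro b
    induction b using Nat.strong_induction_on with
    | _ b ih =>
      have hsum := hcoefsh b
      rw [Polynomial.coeff_mul, ← Finset.add_sum_erase _ _ (Finset.mem_antidiagonal.mpr (zero_add b) : ((0, b) : ℕ × ℕ) ∈ _)]
        at hsum
      have hrest : ∑ x ∈ (Finset.antidiagonal b).erase (0, b), s.coeff x.1 * h.coeff x.2 ∈ 𝔭 ^ (m - b) := by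
        refine Ideal.sum_mem _ fun x hx => ?_
        obtain ⟨hxne, hx'⟩ := Finset.mem_erase.mp hx
        have hx'' := Finset.mem_antidiagonal.mp hx'
        have hlt : x.2 < b := by
          by_contra hge
          apply hxne
          have h2 : x.2 = b := by omega
          have h1 : x.1 = 0 := by omega
          exact Prod.ext h1 h2
        exact Ideal.pow_le_pow_right (by omega) (Ideal.mul_mem_left _ _ (ih x.2 hlt))
      have hmain : s.coeff 0 * h.coeff b ∈ 𝔭 ^ (m - b) := by
        have := Ideal.sub_mem _ hsum hrest
        simpa using this
      have hs0' : s.coeff 0 ∉ Ideal.span (u '' ↑T) := by rwa [← hzr]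
      have hmain' : s.coeff 0 * h.coeff b ∈ Ideal.span (u '' ↑T) ^ (m - b) := by rwa [← hzr]
      have := mem_pow_span_image_rsop_of_mul_mem hd u hu T hs0' (m - b) hmain'
      rwa [← hzr] at this
  intro i hi
  have hi' := Finset.mem_Icc.mp hi
  have := hleg (m - i)
  rwa [show m - (m - i) = i by omega] at this

end Summit.ResolutionOfSingularities.ResolutionOfSingularities.Theorems.SigmaMaxModificationsCorridor3.Helpers

end
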